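import Summits.HodgeConjecture.HodgeConjecture.Theorems.Q8BireflectionRecognitionPoincare
import HarnessLib

/-!
# Route `Q8SymplecticPowers`, crux K1Q — bireflection recognition RELATIVE to an invariant subspace
# (the d6 meridian moves the two merging `(−2)`-classes, so `γ ≡ 1 mod V₁ ⊕ V₂` holds on `ker(τ*² + 1)`, not on all of `H²`)

Support file for crux K1Q (stmt-HodgeConjecture-24190; `--supports … --as helper`). Prover seat `hodge-nonav-prover-Ax` (g18).
Sequel of `Q8BireflectionRecognition` ∕ `Q8BireflectionRecognitionPoincare` (g17), which convert the LOCAL-MONODROMY SHAPE of a d6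
meridian `γ` (two `A`-rotated vanishing planes `V₁ ⊥ V₂`, `γ = A` on `V₁`, `γ = A⁻¹` on `V₂`, `γ ≡ 1 mod V₁ ⊕ V₂`) into the `h_bi`
clause of stub S5 `stub_monodromyBireflectionQ`. Those two theorems ask `γ x − x ∈ V₁ ⊔ V₂` for EVERY `x ∈ H = H²(X_s; ℚ)`. The
geometry of the d6 degeneration (memo ROUTE-P3v27 §1 (C22)) does not give that: near each of the two `A₃`-type points the member is
the minimal resolution of `{XY = S⁴ + ε}/ι`, whose two `A₁` points `S = 0, X = −Y, X² = −ε` are EXCHANGED by the meridian (`ε ↦ e^{2πiθ}ε`),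
so `γ` swaps the classes `E₁, E₂` of the two `(−2)`-curves — `γ E₁ − E₁ = E₂ − E₁ ∉ V₁ ⊕ V₂`. These classes are fixed by the deck
generator `τ` (`τ : S ↦ iS` fixes both points), i.e. lie in `ker(A − 1) ⊆ ker(A² − 1)`, which is `Q`-orthogonal to `ker(A² + 1) ⊇ V₁ ⊕ V₂`;
on `ker(A² + 1)` the shape `γ x − x ∈ V₁ ⊔ V₂` DOES hold. This file supplies the matching algebra:

* §1 `map_baseChange_comap` — transport `((W ∩ U)_L ↦ W_L)` along `φ_U = (U ↪ H)_L` for `W ≤ U`.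
* §2 **`exists_bireflection_datum_of_localMonodromy_relative`** — the recognition theorem with `γ x − x ∈ V₁ ⊔ V₂` asked only for
  `x` in a subspace `U ≥ W` stable under `A, B, γ` on which `Q` is non-degenerate (reduction to the g17 theorem applied to the
  `K`-space `U`, then push-forward along `φ_U`).
* §3 **`exists_bireflection_datum_of_localMonodromy_sq`** — the instance `U = ker(A² + 1)` (`= eigenspace (A ^ 2) (−1)`, the
  ambient of S5's `Mv`): if `A` is a `Q`-isometry of order dividing `4`, `B` commutes with `A²` and `γ` with `A`, then `Q` is
  automatically non-degenerate on `U` and `U` is stable, so ONLY global Poincaré duality (`Q` non-degenerate on `H`) and the shape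
  on `ker(A² + 1)` are needed — the target the geometric bricks L6-4∕L6-6 should aim at.

HONEST FRAMING: linear algebra only (axioms standard, no named fact); the geometric bricks L6-1…L6-6 are NOT touched; K1Q ∕ HC NOT
proved; item 24190 OPEN.
-/

noncomputable section

set_option linter.dupNamespace false

namespace Summit.HodgeConjecture.HodgeConjecture.Theorems.Q8BireflectionRecognitionRelative

open Module Literature.AlgebraicGeometry.HodgeTheory
open Summit.HodgeConjecture.HodgeConjecture.Theorems.Q8BireflectionGroupDensityAmbient
open Summit.HodgeConjecture.HodgeConjecture.Theorems.Q8BireflectionRecognition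
open LinearMap (BilinForm)
open scoped TensorProduct

variable {K : Type*} [Field K] {L : Type*} [Field L] [Algebra K L] {H : Type*} [AddCommGroup H] [Module K H]

/-! ### §1 Transport for a pair `W ≤ U` -/

/-- For `W ≤ U ≤ H`: the image under `φ_U = (U.subtype)_L` of the base change of `W` viewed inside `U` is `W.baseChange L`. -/
theorem map_baseChange_comap {U W : Submodule K H} (hWU : W ≤ U) :
    ((W.comap U.subtype).baseChange L).map (U.subtype.baseChange L) = W.baseChange L := by
  have hc : U.subtype ∘ₗ (W.comap U.subtype).subtype =
      W.subtype ∘ₗ ((Submodule.comapSubtypeEquivOfLe hWU : W.comap U.subtype ≃ₗ[K] W) :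
        W.comap U.subtype →ₗ[K] W) :=
    LinearMap.ext fun _ => rfl
  have hsurj : Function.Surjective
      (((Submodule.comapSubtypeEquivOfLe hWU : W.comap U.subtype ≃ₗ[K] W) :
        W.comap U.subtype →ₗ[K] W).baseChange L) := by
    rw [LinearMap.baseChange_eq_ltensor]
    exact LinearMap.lTensor_surjective L (Submodule.comapSubtypeEquivOfLe hWU).surjective
  rw [Submodule.baseChange, Submodule.baseChange, ← LinearMap.range_comp, ← LinearMap.baseChange_comp, hc,
    LinearMap.baseChange_comp, LinearMap.range_comp, LinearMap.range_eq_top.2 hsurj, Submodule.map_top]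

/-- Membership form of `map_baseChange_comap`: `x ∈ W.baseChange L` iff `x = φ_U y` with `y ∈ (W ∩ U).baseChange L`. -/
theorem mem_baseChange_iff_exists_comap {U W : Submodule K H} (hWU : W ≤ U) {x : L ⊗[K] H} :
    x ∈ W.baseChange L ↔ ∃ y ∈ (W.comap U.subtype).baseChange L, U.subtype.baseChange L y = x := by
  rw [← map_baseChange_comap (L := L) hWU, Submodule.mem_map]

/-! ### §2 The recognition theorem relative to an invariant non-degenerate subspace `U` -/

section Relative

variable [CharZero L] [FiniteDimensional K H]

/-- **BIREFLECTION RECOGNITION, relative form.** As `exists_bireflection_datum_of_localMonodromy'`, but the local-monodromy shape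
`γ x − x ∈ V₁ ⊔ V₂` is asked only for `x ∈ U`, where `U ≥ W ≥ V₁, V₂` is a subspace stable under `A`, `B`, `γ` on which `Q` is
non-degenerate. (Reduction: apply the g17 theorem to the `K`-space `U` with the restricted data, push forward along `(U ↪ H)_L`.) -/
theorem exists_bireflection_datum_of_localMonodromy_relative {Q : BilinForm K H} (hQs : ∀ x y, Q x y = Q y x)
    {A B : H →ₗ[K] H} (haQ : ∀ x y, Q (A x) (A y) = Q x y) (hQb : ∀ x y, Q (B x) (B y) = Q x y) {γ : H ≃ₗ[K] H}
    (hγA : ∀ x, γ (A x) = A (γ x)) (hγQ : ∀ x y, Q (γ x) (γ y) = Q x y)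
    (U : Submodule K H) (hAU : ∀ x ∈ U, A x ∈ U) (hBU : ∀ x ∈ U, B x ∈ U) (hγU : ∀ x ∈ U, γ x ∈ U)
    (hQU : ∀ x ∈ U, (∀ y ∈ U, Q x y = 0) → x = 0)
    (V₁ V₂ W : Submodule K H) (hV₁W : V₁ ≤ W) (hV₂W : V₂ ≤ W) (hWU : W ≤ U)
    (hdim₁ : finrank K V₁ = 2) (hdim₂ : finrank K V₂ = 2) (hAV₁ : ∀ x ∈ V₁, A x ∈ V₁)
    (hAV₂ : ∀ x ∈ V₂, A x ∈ V₂) (haa₁ : ∀ x ∈ V₁, A (A x) = -x) (haa₂ : ∀ x ∈ V₂, A (A x) = -x)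
    (hBV₁ : ∀ x ∈ V₁, B x ∈ V₂) (hBV₂ : ∀ x ∈ V₂, B x ∈ V₁) (hbb₁ : ∀ x ∈ V₁, B (B x) = -x) (hbb₂ : ∀ x ∈ V₂, B (B x) = -x)
    (hab₁ : ∀ x ∈ V₁, A (B x) = -B (A x)) (hab₂ : ∀ x ∈ V₂, A (B x) = -B (A x)) (horth : ∀ x ∈ V₁, ∀ y ∈ V₂, Q x y = 0)
    (hγV : ∀ x ∈ U, γ x - x ∈ V₁ ⊔ V₂) (hγ₁ : ∀ x ∈ V₁, γ x = A x) (hγ₂ : ∀ x ∈ V₂, γ x = -A x) {i : L} (hi : i * i = -1) :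
    ∃ ℓp ℓm : L ⊗[K] H, ℓp ∈ W.baseChange L ∧ ℓm ∈ W.baseChange L ∧ A.baseChange L ℓp = i • ℓp ∧ A.baseChange L ℓm = i • ℓm ∧
      (Q.baseChange L) ℓp (B.baseChange L ℓm) ≠ 0 ∧ (γ.toLinearMap.baseChange L) ℓp = i • ℓp ∧
      (γ.toLinearMap.baseChange L) ℓm = (-i) • ℓm ∧
      ∀ x ∈ W.baseChange L, A.baseChange L x = i • x → (Q.baseChange L) x (B.baseChange L ℓp) = 0 →
        (Q.baseChange L) x (B.baseChange L ℓm) = 0 → (γ.toLinearMap.baseChange L) x = x := by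
  classical
  -- ### the data restricted to `U`
  let QU : BilinForm K U := Q.compl₁₂ U.subtype U.subtype
  have hQU_apply : ∀ x y : U, QU x y = Q (x : H) (y : H) := fun x y => rfl
  let AU : U →ₗ[K] U := A.restrict hAU
  have hAU_apply : ∀ x : U, ((AU x : U) : H) = A x := fun x => rfl
  let BU : U →ₗ[K] U := B.restrict hBU
  have hBU_apply : ∀ x : U, ((BU x : U) : H) = B x := fun x => rfl
  have hγinj : Function.Injective ((γ : H →ₗ[K] H).restrict hγU) := fun x y hxy => by
    apply Subtype.ext
    have h := congrArg (fun z : U => (z : H)) hxy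
    exact γ.injective h
  let γU : U ≃ₗ[K] U := LinearEquiv.ofInjectiveEndo _ hγinj
  have hγU_apply : ∀ x : U, ((γU x : U) : H) = γ x := fun x => by
    show ((LinearEquiv.ofInjectiveEndo _ hγinj x : U) : H) = γ x
    rw [LinearEquiv.coe_ofInjectiveEndo, LinearMap.coe_restrict_apply]
    rfl
  -- the planes and `W` viewed inside `U`
  let V₁' : Submodule K U := V₁.comap U.subtype
  let V₂' : Submodule K U := V₂.comap U.subtype
  let W' : Submodule K U := W.comap U.subtype
  have hV₁U : V₁ ≤ U := hV₁W.trans hWU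
  have hV₂U : V₂ ≤ U := hV₂W.trans hWU
  have hm₁ : ∀ {x : U}, x ∈ V₁' ↔ (x : H) ∈ V₁ := fun {x} => Submodule.mem_comap
  have hm₂ : ∀ {x : U}, x ∈ V₂' ↔ (x : H) ∈ V₂ := fun {x} => Submodule.mem_comap
  -- ### the hypotheses of the g17 theorem on `U`
  have hQs' : ∀ x y : U, QU x y = QU y x := fun x y => hQs x y
  have hQn' : QU.Nondegenerate :=
    ⟨fun a ha => Subtype.ext (hQU a a.2 fun y hy => ha ⟨y, hy⟩),
      fun a ha => Subtype.ext (hQU a a.2 fun y hy => by rw [hQs]; exact ha ⟨y, hy⟩)⟩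
  have haQ' : ∀ x y : U, QU (AU x) (AU y) = QU x y := fun x y => haQ x y
  have hQb' : ∀ x y : U, QU (BU x) (BU y) = QU x y := fun x y => hQb x y
  have hγA' : ∀ x : U, γU (AU x) = AU (γU x) := fun x =>
    Subtype.ext (by rw [hγU_apply, hAU_apply, hAU_apply, hγU_apply]; exact hγA x)
  have hγQ' : ∀ x y : U, QU (γU x) (γU y) = QU x y := fun x y => by
    rw [hQU_apply, hQU_apply, hγU_apply, hγU_apply]; exact hγQ x y
  have hV₁W' : V₁' ≤ W' := Submodule.comap_mono hV₁W
  have hV₂W' : V₂' ≤ W' := Submodule.comap_mono hV₂W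
  have hdim₁' : finrank K V₁' = 2 := by rw [(Submodule.comapSubtypeEquivOfLe hV₁U).finrank_eq]; exact hdim₁
  have hdim₂' : finrank K V₂' = 2 := by rw [(Submodule.comapSubtypeEquivOfLe hV₂U).finrank_eq]; exact hdim₂
  have hAV₁' : ∀ x ∈ V₁', AU x ∈ V₁' := fun x hx => hm₁.2 (by rw [hAU_apply]; exact hAV₁ _ (hm₁.1 hx))
  have hAV₂' : ∀ x ∈ V₂', AU x ∈ V₂' := fun x hx => hm₂.2 (by rw [hAU_apply]; exact hAV₂ _ (hm₂.1 hx))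
  have haa₁' : ∀ x ∈ V₁', AU (AU x) = -x := fun x hx =>
    Subtype.ext (by rw [hAU_apply, hAU_apply, Submodule.coe_neg]; exact haa₁ _ (hm₁.1 hx))
  have haa₂' : ∀ x ∈ V₂', AU (AU x) = -x := fun x hx =>
    Subtype.ext (by rw [hAU_apply, hAU_apply, Submodule.coe_neg]; exact haa₂ _ (hm₂.1 hx))
  have hBV₁' : ∀ x ∈ V₁', BU x ∈ V₂' := fun x hx => hm₂.2 (by rw [hBU_apply]; exact hBV₁ _ (hm₁.1 hx))
  have hBV₂' : ∀ x ∈ V₂', BU x ∈ V₁' := fun x hx => hm₁.2 (by rw [hBU_apply]; exact hBV₂ _ (hm₂.1 hx))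
  have hbb₁' : ∀ x ∈ V₁', BU (BU x) = -x := fun x hx =>
    Subtype.ext (by rw [hBU_apply, hBU_apply, Submodule.coe_neg]; exact hbb₁ _ (hm₁.1 hx))
  have hbb₂' : ∀ x ∈ V₂', BU (BU x) = -x := fun x hx =>
    Subtype.ext (by rw [hBU_apply, hBU_apply, Submodule.coe_neg]; exact hbb₂ _ (hm₂.1 hx))
  have hab₁' : ∀ x ∈ V₁', AU (BU x) = -BU (AU x) := fun x hx =>
    Subtype.ext (by rw [hAU_apply, hBU_apply, Submodule.coe_neg, hBU_apply, hAU_apply]; exact hab₁ _ (hm₁.1 hx))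
  have hab₂' : ∀ x ∈ V₂', AU (BU x) = -BU (AU x) := fun x hx =>
    Subtype.ext (by rw [hAU_apply, hBU_apply, Submodule.coe_neg, hBU_apply, hAU_apply]; exact hab₂ _ (hm₂.1 hx))
  have horth' : ∀ x ∈ V₁', ∀ y ∈ V₂', QU x y = 0 := fun x hx y hy => horth _ (hm₁.1 hx) _ (hm₂.1 hy)
  have hγV' : ∀ x : U, γU x - x ∈ V₁' ⊔ V₂' := fun x => by
    obtain ⟨v₁, hv₁, v₂, hv₂, h⟩ := Submodule.mem_sup.1 (hγV x x.2)
    refine Submodule.mem_sup.2 ⟨⟨v₁, hV₁U hv₁⟩, hm₁.2 hv₁, ⟨v₂, hV₂U hv₂⟩, hm₂.2 hv₂, Subtype.ext ?_⟩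
    rw [Submodule.coe_add, Submodule.coe_sub, hγU_apply]
    exact h
  have hγ₁' : ∀ x ∈ V₁', γU x = AU x := fun x hx =>
    Subtype.ext (by rw [hγU_apply, hAU_apply]; exact hγ₁ _ (hm₁.1 hx))
  have hγ₂' : ∀ x ∈ V₂', γU x = -AU x := fun x hx =>
    Subtype.ext (by rw [hγU_apply, Submodule.coe_neg, hAU_apply]; exact hγ₂ _ (hm₂.1 hx))
  -- ### the g17 theorem on `U`
  obtain ⟨ℓp, ℓm, h1, h2, h3, h4, h5, h6, h7, h8⟩ :=
    exists_bireflection_datum_of_localMonodromy' (L := L) hQs' hQn' haQ' hQb' hγA' hγQ' V₁' V₂' W' hV₁W' hV₂W' hdim₁'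
      hdim₂' hAV₁' hAV₂' haa₁' haa₂' hBV₁' hBV₂' hbb₁' hbb₂' hab₁' hab₂' horth' hγV' hγ₁' hγ₂' hi
  -- ### push forward along `φ = (U.subtype)_L`
  let φ := U.subtype.baseChange L
  have hφA : ∀ y, φ (AU.baseChange L y) = A.baseChange L (φ y) := fun y =>
    subtype_baseChange_comm U (η := AU) (f := A) (fun x => hAU_apply x) y
  have hφB : ∀ y, φ (BU.baseChange L y) = B.baseChange L (φ y) := fun y =>
    subtype_baseChange_comm U (η := BU) (f := B) (fun x => hBU_apply x) y
  have hφγ : ∀ y, φ ((γU : U →ₗ[K] U).baseChange L y) = (γ : H →ₗ[K] H).baseChange L (φ y) := fun y =>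
    subtype_baseChange_comm U (η := (γU : U →ₗ[K] U)) (f := (γ : H →ₗ[K] H)) (fun x => hγU_apply x) y
  have hφQ : ∀ y y', Q.baseChange L (φ y) (φ y') = QU.baseChange L y y' := fun y y' =>
    (baseChange_compl₁₂_subtype U Q y y').symm
  have hφW : ∀ y ∈ W'.baseChange L, φ y ∈ W.baseChange L := fun y hy => by
    rw [← map_baseChange_comap (L := L) hWU]
    exact Submodule.mem_map_of_mem hy
  have hφinj : Function.Injective φ := subtype_baseChange_injective U
  refine ⟨φ ℓp, φ ℓm, hφW _ h1, hφW _ h2, ?_, ?_, ?_, ?_, ?_, ?_⟩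
  · rw [← hφA, h3, map_smul]
  · rw [← hφA, h4, map_smul]
  · rw [← hφB, hφQ]; exact h5
  · rw [← hφγ, h6, map_smul]
  · rw [← hφγ, h7, map_smul]
  · intro x hx hAx hxp hxm
    obtain ⟨y, hy, rfl⟩ := (mem_baseChange_iff_exists_comap (L := L) hWU).1 hx
    have hAy : AU.baseChange L y = i • y := hφinj (by rw [hφA, hAx, map_smul])
    have hyp : QU.baseChange L y (BU.baseChange L ℓp) = 0 := by rw [← hφQ, hφB]; exact hxp
    have hym : QU.baseChange L y (BU.baseChange L ℓm) = 0 := by rw [← hφQ, hφB]; exact hxm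
    rw [← hφγ, h8 y hy hAy hyp hym]

end Relative

/-! ### §3 The instance `U = ker(A² + 1)`: only global Poincaré duality is needed -/

section Sq

variable [CharZero L] [FiniteDimensional K H]

/-- `2 ≠ 0` in `K` when `K` maps to a field `L'` of characteristic zero. -/
theorem two_ne_zero_of_algebra (L' : Type*) [Field L'] [CharZero L'] [Algebra K L'] : (2 : K) ≠ 0 := fun h =>
  two_ne_zero (α := L') (by rw [← map_ofNat (algebraMap K L') 2, h, map_zero])

omit [FiniteDimensional K H] in
/-- If `A` is a `Q`-isometry with `A⁴ = 1` and `Q` is non-degenerate on `H` (`char K ≠ 2`), then `Q` is non-degenerate on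
`ker(A² + 1)`: for `x` there and any `z`, `Q(x, z + A²z) = 0` and `z − A²z ∈ ker(A² + 1)`. -/
theorem separating_on_eigenspace_sq_neg_one (h2K : (2 : K) ≠ 0) {Q : BilinForm K H} (hQn : Q.Nondegenerate)
    {A : H →ₗ[K] H} (haQ : ∀ x y, Q (A x) (A y) = Q x y) (hA4 : ∀ x, A (A (A (A x))) = x) :
    ∀ x ∈ Module.End.eigenspace (A ^ 2) (-1 : K), (∀ y ∈ Module.End.eigenspace (A ^ 2) (-1 : K), Q x y = 0) → x = 0 := by
  have hmem : ∀ {x : H}, x ∈ Module.End.eigenspace (A ^ 2) (-1 : K) ↔ A (A x) = -x := fun {x} => by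
    rw [Module.End.mem_eigenspace_iff, pow_two, Module.End.mul_apply, neg_one_smul]
  intro x hx hxy
  have hAAx : A (A x) = -x := hmem.1 hx
  refine hQn.1 x fun z => ?_
  -- `Q(x, A²z) = −Q(x, z)`
  have h1 : Q x (A (A z)) = -Q x z := by
    have h := haQ (A x) (A z)
    rw [haQ x z, hAAx, map_neg, LinearMap.neg_apply] at h
    rw [← h, neg_neg]
  -- `z − A²z ∈ ker(A² + 1)`
  have h2 : z - A (A z) ∈ Module.End.eigenspace (A ^ 2) (-1 : K) := by
    rw [hmem, map_sub, map_sub, hA4, neg_sub]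
  have h3 := hxy _ h2
  rw [map_sub, h1, sub_neg_eq_add, ← two_mul] at h3
  exact (mul_eq_zero.1 h3).resolve_left h2K

/-- **BIREFLECTION RECOGNITION on `ker(A² + 1)` from global Poincaré duality.** `K → L` fields, `char L = 0`, `i² = −1` in `L`;
`Q` symmetric and NON-DEGENERATE on the finite-dimensional `K`-space `H`; `A` a `Q`-isometry with `A⁴ = 1`, `B` a `Q`-isometry
commuting with `A²`, `γ ∈ GL_K(H)` a `Q`-isometry commuting with `A`; planes `V₁, V₂ ≤ W ≤ ker(A² + 1)` of dimension `2` with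
`A V_k ⊆ V_k`, `A² = −1` on `V_k`, `B V₁ ⊆ V₂`, `B V₂ ⊆ V₁`, `B² = −1` and `AB = −BA` on `V_k`, `V₁ ⊥ V₂`; LOCAL MONODROMY SHAPE ON
`ker(A² + 1)`: `γ x − x ∈ V₁ ⊔ V₂` for every `x` with `A²x = −x`, `γ = A` on `V₁`, `γ = −A` on `V₂`. Then the `h_bi` clause of stub S5
holds for `W`: `i`-eigenvectors `ℓp, ℓm ∈ W.baseChange L` of `A_L` with `Q_L(ℓp, B_L ℓm) ≠ 0`, `γ_L ℓp = i ℓp`, `γ_L ℓm = −i ℓm`, and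
`γ_L x = x` for every `i`-eigenvector `x ∈ W.baseChange L` orthogonal to `B_L ℓp, B_L ℓm`. (The two `(−2)`-classes exchanged by the
d6 meridian live in `ker(A² − 1)` and are invisible here.) -/
theorem exists_bireflection_datum_of_localMonodromy_sq {Q : BilinForm K H} (hQs : ∀ x y, Q x y = Q y x) (hQn : Q.Nondegenerate)
    {A B : H →ₗ[K] H} (haQ : ∀ x y, Q (A x) (A y) = Q x y) (hA4 : ∀ x, A (A (A (A x))) = x)
    (hQb : ∀ x y, Q (B x) (B y) = Q x y) (hBA : ∀ x, B (A (A x)) = A (A (B x))) {γ : H ≃ₗ[K] H}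
    (hγA : ∀ x, γ (A x) = A (γ x)) (hγQ : ∀ x y, Q (γ x) (γ y) = Q x y) (V₁ V₂ W : Submodule K H) (hV₁W : V₁ ≤ W)
    (hV₂W : V₂ ≤ W) (hW : W ≤ Module.End.eigenspace (A ^ 2) (-1 : K))
    (hdim₁ : finrank K V₁ = 2) (hdim₂ : finrank K V₂ = 2) (hAV₁ : ∀ x ∈ V₁, A x ∈ V₁)
    (hAV₂ : ∀ x ∈ V₂, A x ∈ V₂) (haa₁ : ∀ x ∈ V₁, A (A x) = -x) (haa₂ : ∀ x ∈ V₂, A (A x) = -x)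
    (hBV₁ : ∀ x ∈ V₁, B x ∈ V₂) (hBV₂ : ∀ x ∈ V₂, B x ∈ V₁) (hbb₁ : ∀ x ∈ V₁, B (B x) = -x) (hbb₂ : ∀ x ∈ V₂, B (B x) = -x)
    (hab₁ : ∀ x ∈ V₁, A (B x) = -B (A x)) (hab₂ : ∀ x ∈ V₂, A (B x) = -B (A x)) (horth : ∀ x ∈ V₁, ∀ y ∈ V₂, Q x y = 0)
    (hγV : ∀ x, A (A x) = -x → γ x - x ∈ V₁ ⊔ V₂) (hγ₁ : ∀ x ∈ V₁, γ x = A x) (hγ₂ : ∀ x ∈ V₂, γ x = -A x)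
    {i : L} (hi : i * i = -1) :
    ∃ ℓp ℓm : L ⊗[K] H, ℓp ∈ W.baseChange L ∧ ℓm ∈ W.baseChange L ∧ A.baseChange L ℓp = i • ℓp ∧ A.baseChange L ℓm = i • ℓm ∧
      (Q.baseChange L) ℓp (B.baseChange L ℓm) ≠ 0 ∧ (γ.toLinearMap.baseChange L) ℓp = i • ℓp ∧
      (γ.toLinearMap.baseChange L) ℓm = (-i) • ℓm ∧
      ∀ x ∈ W.baseChange L, A.baseChange L x = i • x → (Q.baseChange L) x (B.baseChange L ℓp) = 0 →
        (Q.baseChange L) x (B.baseChange L ℓm) = 0 → (γ.toLinearMap.baseChange L) x = x := by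
  set U : Submodule K H := Module.End.eigenspace (A ^ 2) (-1 : K) with hU
  have hmem : ∀ {x : H}, x ∈ U ↔ A (A x) = -x := fun {x} => by
    rw [hU, Module.End.mem_eigenspace_iff, pow_two, Module.End.mul_apply, neg_one_smul]
  have hAU : ∀ x ∈ U, A x ∈ U := fun x hx => hmem.2 (by rw [hmem.1 hx, map_neg])
  have hBU : ∀ x ∈ U, B x ∈ U := fun x hx => hmem.2 (by rw [← hBA, hmem.1 hx, map_neg])
  have hγU : ∀ x ∈ U, γ x ∈ U := fun x hx => hmem.2 (by rw [← hγA, ← hγA, hmem.1 hx, map_neg])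
  have hQU : ∀ x ∈ U, (∀ y ∈ U, Q x y = 0) → x = 0 :=
    separating_on_eigenspace_sq_neg_one (two_ne_zero_of_algebra L) hQn haQ hA4
  exact exists_bireflection_datum_of_localMonodromy_relative hQs haQ hQb hγA hγQ U hAU hBU hγU hQU V₁ V₂ W hV₁W hV₂W hW hdim₁
    hdim₂ hAV₁ hAV₂ haa₁ haa₂ hBV₁ hBV₂ hbb₁ hbb₂ hab₁ hab₂ horth (fun x hx => hγV x (hmem.1 hx)) hγ₁ hγ₂ hi

end Sq

end Summit.HodgeConjecture.HodgeConjecture.Theorems.Q8BireflectionRecognitionRelative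

end
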